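import Summits.Parity.BatemanHorn.Theorems.SoloInformedTwinBalancedSplit
import Summits.Parity.BatemanHorn.Theorems.SoloInformedTwinPrimeParityFloor

/-!
# SoloInformedTwinFarTailTiers — the three tiers of the twin prime problem read on the
# BALANCED FAR TAIL of the located sum

Solo unit `solo-Parity-informed` (ideation tier, informed mode), session 48; `paper.md` §20
(Corollaries 20.3–20.4, Remark 20.12), `SHARPEST-STATEMENT.md` §2 Theorems C/F and §4L, CLAIMS C125.

`SoloInformedTwinPrimeTiers` (C101) states the three tiers of the twin prime problem on the located
twin sum `T(x) = ∑_{n ≤ x} ∑_{e ∣ n(n+2), e > x^{1-ε}} μ(e) log² e`: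
Tier 0 `-(4C₂+δ)x ≤ T(x) ≤ (4(C-1)C₂+δ)x` (every sieve constant `C`; `C = 4` proved, `C = 2/ϑ` from a
level `ϑ` of the primes, `C = 2` under Elliott–Halberstam), Tier 1 "`T(x) ≥ -(4C₂-c)x` infinitely
often for some `c > 0`" `⟺ π₂(x) ≫ x/log²x` infinitely often `⟹` infinitely many twin primes, Tier 2
`T = o(x) ⟺ π₂(x) ~ 2C₂x/log²x`.  `SoloInformedTwinBalancedSplit` (C120) splits
`T = U + W + R` into the unbalanced pairs `U` (`min(e₁,e₂) ≤ z`), the balanced window `W`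
(`min > z`, `e₁e₂ ≤ Y`) and the BALANCED FAR TAIL `R` (`min > z`, `e₁e₂ > Y`), and proves Tier 2 on `R`:
under `U = o(x)` and `W = o(x)` — the prose theorems (F′), (F) of paper.md §20, typed as hypotheses —
`π₂(x) ~ 2C₂x/log²x ⟺ R = o(x)`.

This file moves Tiers 0 and 1 to `R` as well, under the same two typed hypotheses and for arbitrary
balance / level functions `z, Y : ℕ → ℕ` (cut `y = ⌊x^{1-ε}⌋`):

* Tier 0: `-(4C₂+δ)x ≤ R(x) ≤ (4(C-1)C₂+δ)x` eventually for every sieve constant `C`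
  (`eventually_neg_mul_le_twinBalancedFarSum`, `eventually_twinBalancedFarSum_le_of_twinSieveUpperBound`),
  unconditionally with `12C₂` (`eventually_twinBalancedFarSum_le_mul`), with `4(2/ϑ-1)C₂` from
  `PrimesHaveLevel ϑ` (`eventually_twinBalancedFarSum_le_of_level`), and `|R(x)| ≤ (4C₂+δ)x` under
  Elliott–Halberstam (`eventually_abs_twinBalancedFarSum_le_of_EH`) — the parity floor is the symmetric
  interval also for the balanced pair-Chowla sum;
* Tier 1: `(∃ c > 0, ∃^∞ x, R(x) ≥ -(4C₂-c)x) ⟹ TwinPrimeConjecture`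
  (`twinPrimeConjecture_of_frequently_twinBalancedFarSum_ge`), and exactly
  `(∃ c > 0, ∃^∞ x, π₂(x) ≥ c x/log²x) ⟺ (∃ c > 0, ∃^∞ x, R(x) ≥ (c - 4C₂)x)`
  (`frequently_twinPrimeCount_ge_iff_twinBalancedFarSum_ge`);
* Tier 2 ⟹ Tier 1 on `R` (`frequently_twinBalancedFarSum_ge_of_hardyLittlewood`).

In words: granted the two prose inputs, the twin prime conjecture follows from ANY constant one-sided
saving, along a sequence of `x`, on the balanced pair-Chowla sum
`∑_{e₁,e₂ > z, e₁e₂ > Y} μ(e₁)μ(e₂) log²(e₁e₂) N(e₁,e₂;x)` below its trivial floor `-4C₂x`.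
The real-sequence bookkeeping is generic (`T = U + W + R`, `U, W = o(x)`; §1).  Nothing analytic is
proved here; (F′), (F) remain prose.
-/

namespace Summit.Parity.BatemanHorn.Theorems

open Finset Filter Asymptotics ArithmeticFunction
open scoped ArithmeticFunction.Moebius Topology
open Literature.NumberTheory.Sieve

/-! ### 1. Real-sequence bookkeeping: `T = U + W + R` with `U, W = o(x)` -/

/-- If `U, W = o(x)` then `|U(x) + W(x)| ≤ δx` eventually, for every `δ > 0`. -/
theorem eventually_abs_add_le_mul_of_isLittleO_natCast {U W : ℕ → ℝ}
    (hU : U =o[atTop] fun x : ℕ => (x : ℝ)) (hW : W =o[atTop] fun x : ℕ => (x : ℝ))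
    {δ : ℝ} (hδ : 0 < δ) :
    ∀ᶠ x : ℕ in atTop, |U x + W x| ≤ δ * (x : ℝ) := by
  have h := hU.add hW
  rw [isLittleO_iff] at h
  filter_upwards [h hδ] with x hx
  simpa only [Pi.add_apply, Real.norm_eq_abs, Nat.abs_cast] using hx

/-- Eventual lower bounds `-(K+δ')x ≤ T(x)` (all `δ' > 0`) pass to `R = T - U - W` when `U, W = o(x)`. -/
theorem eventually_neg_mul_le_of_split {T U W R : ℕ → ℝ} (hT : ∀ x, T x = U x + W x + R x)
    (hU : U =o[atTop] fun x : ℕ => (x : ℝ)) (hW : W =o[atTop] fun x : ℕ => (x : ℝ)) {K δ : ℝ}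
    (hδ : 0 < δ) (h : ∀ δ' : ℝ, 0 < δ' → ∀ᶠ x : ℕ in atTop, -(K + δ') * (x : ℝ) ≤ T x) :
    ∀ᶠ x : ℕ in atTop, -(K + δ) * (x : ℝ) ≤ R x := by
  filter_upwards [h (δ / 2) (half_pos hδ),
    eventually_abs_add_le_mul_of_isLittleO_natCast hU hW (half_pos hδ)] with x h1 h2
  rw [hT x] at h1
  have h3 := (abs_le.mp h2).2
  linarith

/-- Eventual upper bounds `T(x) ≤ (K+δ')x` (all `δ' > 0`) pass to `R = T - U - W` when `U, W = o(x)`. -/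
theorem eventually_le_mul_of_split {T U W R : ℕ → ℝ} (hT : ∀ x, T x = U x + W x + R x)
    (hU : U =o[atTop] fun x : ℕ => (x : ℝ)) (hW : W =o[atTop] fun x : ℕ => (x : ℝ)) {K δ : ℝ}
    (hδ : 0 < δ) (h : ∀ δ' : ℝ, 0 < δ' → ∀ᶠ x : ℕ in atTop, T x ≤ (K + δ') * (x : ℝ)) :
    ∀ᶠ x : ℕ in atTop, R x ≤ (K + δ) * (x : ℝ) := by
  filter_upwards [h (δ / 2) (half_pos hδ),
    eventually_abs_add_le_mul_of_isLittleO_natCast hU hW (half_pos hδ)] with x h1 h2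
  rw [hT x] at h1
  have h3 := (abs_le.mp h2).1
  linarith

/-- Eventual two-sided bounds `|T(x)| ≤ (K+δ')x` (all `δ' > 0`) pass to `R = T - U - W`. -/
theorem eventually_abs_le_mul_of_split {T U W R : ℕ → ℝ} (hT : ∀ x, T x = U x + W x + R x)
    (hU : U =o[atTop] fun x : ℕ => (x : ℝ)) (hW : W =o[atTop] fun x : ℕ => (x : ℝ)) {K δ : ℝ}
    (hδ : 0 < δ) (h : ∀ δ' : ℝ, 0 < δ' → ∀ᶠ x : ℕ in atTop, |T x| ≤ (K + δ') * (x : ℝ)) :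
    ∀ᶠ x : ℕ in atTop, |R x| ≤ (K + δ) * (x : ℝ) := by
  filter_upwards [h (δ / 2) (half_pos hδ),
    eventually_abs_add_le_mul_of_isLittleO_natCast hU hW (half_pos hδ)] with x h1 h2
  rw [hT x] at h1
  obtain ⟨h3, h4⟩ := abs_le.mp h2
  obtain ⟨h5, h6⟩ := abs_le.mp h1
  rw [abs_le]
  constructor <;> linarith

/-- A saving `(c - K)x ≤ T(x)` infinitely often (some `c > 0`) passes to `R = T - U - W` (with `c/2`)
when `U, W = o(x)`. -/
theorem frequently_mul_le_of_split {T U W R : ℕ → ℝ} (hT : ∀ x, T x = U x + W x + R x)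
    (hU : U =o[atTop] fun x : ℕ => (x : ℝ)) (hW : W =o[atTop] fun x : ℕ => (x : ℝ)) {K : ℝ}
    (h : ∃ c : ℝ, 0 < c ∧ ∃ᶠ x : ℕ in atTop, (c - K) * (x : ℝ) ≤ T x) :
    ∃ c : ℝ, 0 < c ∧ ∃ᶠ x : ℕ in atTop, (c - K) * (x : ℝ) ≤ R x := by
  obtain ⟨c, hc, hfr⟩ := h
  refine ⟨c / 2, half_pos hc, ?_⟩
  refine (hfr.and_eventually (eventually_abs_add_le_mul_of_isLittleO_natCast hU hW (half_pos hc))).mono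
    fun x hx => ?_
  obtain ⟨h1, h2⟩ := hx
  rw [hT x] at h1
  have h3 := (abs_le.mp h2).2
  linarith

/-! ### 2. The split `T = U + W + R` of the located twin sum, as real sequences -/

section Twin

variable {ε : ℝ} {z Y : ℕ → ℕ}

/-- `T(x; ⌊x^{1-ε}⌋) = U + W + R` (C120), for the cut `rpowCut ε` and arbitrary `z, Y`. -/
theorem twinLocatedSum_rpowCut_split (ε : ℝ) (z Y : ℕ → ℕ) (x : ℕ) :
    twinLocatedSum x (rpowCut ε x)
      = twinUnbalancedSum x (rpowCut ε x) (z x) + twinBalancedWindowSum x (rpowCut ε x) (z x) (Y x)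
        + twinBalancedFarSum x (rpowCut ε x) (z x) (Y x) :=
  twinLocatedSum_eq_unbalanced_add_window_add_far _ _ _ _

/-- The same split solved for `T` as the remainder: `R = (-U) + (-W) + T`. -/
theorem twinBalancedFarSum_rpowCut_split (ε : ℝ) (z Y : ℕ → ℕ) (x : ℕ) :
    twinBalancedFarSum x (rpowCut ε x) (z x) (Y x)
      = -twinUnbalancedSum x (rpowCut ε x) (z x) + -twinBalancedWindowSum x (rpowCut ε x) (z x) (Y x)
        + twinLocatedSum x (rpowCut ε x) := by
  rw [twinLocatedSum_rpowCut_split ε z Y x]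
  ring

/-- The located twin sum with the cut `⌊x^{1-ε}⌋`, unfolded to the expression of C101. -/
theorem twinLocatedSum_rpowCut_eq_sum (ε : ℝ) (x : ℕ) :
    twinLocatedSum x (rpowCut ε x)
      = ∑ n ∈ Icc 1 x, ∑ e ∈ (n * (n + 2)).divisors with ⌊(x : ℝ) ^ (1 - ε)⌋₊ < e,
          (μ e : ℝ) * Real.log e ^ 2 := rfl

/-! ### 3. Tier 0 on the balanced far tail -/

/-- **Tier 0, lower:** under (F′) `U = o(x)` and (F) `W = o(x)`, `R(x) ≥ -(4C₂+δ)x` eventually,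
every `δ > 0` (from `Λ₂ ≥ 0`, C101). -/
theorem eventually_neg_mul_le_twinBalancedFarSum (hε : 0 < ε) (hε1 : ε < 1)
    (hU : (fun x => twinUnbalancedSum x (rpowCut ε x) (z x)) =o[atTop] fun x : ℕ => (x : ℝ))
    (hW : (fun x => twinBalancedWindowSum x (rpowCut ε x) (z x) (Y x)) =o[atTop] fun x : ℕ => (x : ℝ))
    {δ : ℝ} (hδ : 0 < δ) :
    ∀ᶠ x : ℕ in atTop,
      -(4 * twinPrimeConst + δ) * (x : ℝ) ≤ twinBalancedFarSum x (rpowCut ε x) (z x) (Y x) :=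
  eventually_neg_mul_le_of_split (T := fun x => twinLocatedSum x (rpowCut ε x))
    (twinLocatedSum_rpowCut_split ε z Y) hU hW hδ
    fun δ' hδ' => by
      simpa only [twinLocatedSum_rpowCut_eq_sum] using eventually_neg_mul_le_twinTail hε hε1 hδ'

/-- **Tier 0, upper — every sieve constant transfers:** under (F′), (F), `TwinSieveUpperBound C`
gives `R(x) ≤ (4(C-1)C₂+δ)x` eventually, every `δ > 0`. -/
theorem eventually_twinBalancedFarSum_le_of_twinSieveUpperBound {C : ℝ} (hC0 : 0 < C)
    (hCs : TwinSieveUpperBound C) (hε : 0 < ε) (hε1 : ε < 1)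
    (hU : (fun x => twinUnbalancedSum x (rpowCut ε x) (z x)) =o[atTop] fun x : ℕ => (x : ℝ))
    (hW : (fun x => twinBalancedWindowSum x (rpowCut ε x) (z x) (Y x)) =o[atTop] fun x : ℕ => (x : ℝ))
    {δ : ℝ} (hδ : 0 < δ) :
    ∀ᶠ x : ℕ in atTop,
      twinBalancedFarSum x (rpowCut ε x) (z x) (Y x) ≤ (4 * (C - 1) * twinPrimeConst + δ) * (x : ℝ) :=
  eventually_le_mul_of_split (T := fun x => twinLocatedSum x (rpowCut ε x))
    (twinLocatedSum_rpowCut_split ε z Y) hU hW hδ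
    fun δ' hδ' => by
      simpa only [twinLocatedSum_rpowCut_eq_sum] using
        eventually_twinTail_le_of_twinSieveUpperBound hC0 hCs hε hε1 hδ'

/-- **Tier 0, upper (unconditional sieve end):** under (F′), (F), `R(x) ≤ (12C₂+δ)x` eventually — the
PROVED sieve constant `C = 4` (`TwinSieveFour.twinSieveUpperBound_four`). -/
theorem eventually_twinBalancedFarSum_le_mul (hε : 0 < ε) (hε1 : ε < 1)
    (hU : (fun x => twinUnbalancedSum x (rpowCut ε x) (z x)) =o[atTop] fun x : ℕ => (x : ℝ))
    (hW : (fun x => twinBalancedWindowSum x (rpowCut ε x) (z x) (Y x)) =o[atTop] fun x : ℕ => (x : ℝ))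
    {δ : ℝ} (hδ : 0 < δ) :
    ∀ᶠ x : ℕ in atTop,
      twinBalancedFarSum x (rpowCut ε x) (z x) (Y x) ≤ (12 * twinPrimeConst + δ) * (x : ℝ) :=
  eventually_le_mul_of_split (T := fun x => twinLocatedSum x (rpowCut ε x))
    (twinLocatedSum_rpowCut_split ε z Y) hU hW hδ
    fun δ' hδ' => by
      simpa only [twinLocatedSum_rpowCut_eq_sum] using eventually_twinTail_le_mul hε hε1 hδ'

/-- **Tier 0 per level of distribution:** under (F′), (F), `PrimesHaveLevel ϑ` gives
`R(x) ≤ (4(2/ϑ-1)C₂+δ)x` eventually (C103 on `R`; `ϑ = 1/2` is Bombieri–Vinogradov). -/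
theorem eventually_twinBalancedFarSum_le_of_level {θ : ℝ} (hθ : 0 < θ) (hL : PrimesHaveLevel θ)
    (hε : 0 < ε) (hε1 : ε < 1)
    (hU : (fun x => twinUnbalancedSum x (rpowCut ε x) (z x)) =o[atTop] fun x : ℕ => (x : ℝ))
    (hW : (fun x => twinBalancedWindowSum x (rpowCut ε x) (z x) (Y x)) =o[atTop] fun x : ℕ => (x : ℝ))
    {δ : ℝ} (hδ : 0 < δ) :
    ∀ᶠ x : ℕ in atTop,
      twinBalancedFarSum x (rpowCut ε x) (z x) (Y x)
        ≤ (4 * (2 / θ - 1) * twinPrimeConst + δ) * (x : ℝ) :=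
  eventually_le_mul_of_split (T := fun x => twinLocatedSum x (rpowCut ε x))
    (twinLocatedSum_rpowCut_split ε z Y) hU hW hδ
    fun δ' hδ' => by
      simpa only [twinLocatedSum_rpowCut_eq_sum] using eventually_twinTail_le_of_level hθ hL hε hε1 hδ'

/-- **The Elliott–Halberstam parity floor on the balanced far tail:** under (F′), (F) and EH,
`|R(x)| ≤ (4C₂+δ)x` eventually, every `δ > 0` — the symmetric interval `[-4C₂, 4C₂]` for `R/x`
(C103 on `R`; EH is a HYPOTHESIS). -/
theorem eventually_abs_twinBalancedFarSum_le_of_EH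
    (hEH : Literature.NumberTheory.Sieve.LevelOfDistribution.ElliottHalberstam)
    (hε : 0 < ε) (hε1 : ε < 1)
    (hU : (fun x => twinUnbalancedSum x (rpowCut ε x) (z x)) =o[atTop] fun x : ℕ => (x : ℝ))
    (hW : (fun x => twinBalancedWindowSum x (rpowCut ε x) (z x) (Y x)) =o[atTop] fun x : ℕ => (x : ℝ))
    {δ : ℝ} (hδ : 0 < δ) :
    ∀ᶠ x : ℕ in atTop,
      |twinBalancedFarSum x (rpowCut ε x) (z x) (Y x)| ≤ (4 * twinPrimeConst + δ) * (x : ℝ) :=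
  eventually_abs_le_mul_of_split (T := fun x => twinLocatedSum x (rpowCut ε x))
    (twinLocatedSum_rpowCut_split ε z Y) hU hW hδ
    fun δ' hδ' => by
      simpa only [twinLocatedSum_rpowCut_eq_sum] using eventually_abs_twinTail_le_of_EH hEH hε hε1 hδ'

/-! ### 4. Tier 1 on the balanced far tail: the twin prime conjecture -/

/-- **The twin prime conjecture from any saving on the balanced far tail.**  Under (F′) `U = o(x)`
and (F) `W = o(x)`: if for some `c > 0` and infinitely many `x`,
`∑_{e₁,e₂ > z(x), e₁e₂ > Y(x)} 𝟙[e₁e₂ > x^{1-ε}] μ(e₁)μ(e₂) log²(e₁e₂) N(e₁,e₂;x) ≥ -(4C₂ - c)x`,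
then there are infinitely many twin primes. -/
theorem twinPrimeConjecture_of_frequently_twinBalancedFarSum_ge (hε : 0 < ε) (hε1 : ε < 1)
    (hU : (fun x => twinUnbalancedSum x (rpowCut ε x) (z x)) =o[atTop] fun x : ℕ => (x : ℝ))
    (hW : (fun x => twinBalancedWindowSum x (rpowCut ε x) (z x) (Y x)) =o[atTop] fun x : ℕ => (x : ℝ))
    (h : ∃ c : ℝ, 0 < c ∧ ∃ᶠ x : ℕ in atTop,
      (c - 4 * twinPrimeConst) * (x : ℝ) ≤ twinBalancedFarSum x (rpowCut ε x) (z x) (Y x)) :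
    TwinPrimeConjecture := by
  refine twinPrimeConjecture_of_frequently_twinTail_ge hε hε1 ?_
  have h' := frequently_mul_le_of_split (R := fun x => twinLocatedSum x (rpowCut ε x))
    (twinBalancedFarSum_rpowCut_split ε z Y) hU.neg_left hW.neg_left h
  simpa only [twinLocatedSum_rpowCut_eq_sum] using h'

/-- **Tier 1 exactly, on the balanced far tail.**  Under (F′), (F):
`(∃ c > 0, ∃^∞ x, π₂(x) ≥ c·x/log²x) ⟺ (∃ c > 0, ∃^∞ x, R(x) ≥ (c - 4C₂)·x)`. -/
theorem frequently_twinPrimeCount_ge_iff_twinBalancedFarSum_ge (hε : 0 < ε) (hε1 : ε < 1)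
    (hU : (fun x => twinUnbalancedSum x (rpowCut ε x) (z x)) =o[atTop] fun x : ℕ => (x : ℝ))
    (hW : (fun x => twinBalancedWindowSum x (rpowCut ε x) (z x) (Y x)) =o[atTop] fun x : ℕ => (x : ℝ)) :
    (∃ c : ℝ, 0 < c ∧ ∃ᶠ x : ℕ in atTop, c * (x : ℝ) / Real.log x ^ 2 ≤ (twinPrimeCount x : ℝ)) ↔
      (∃ c : ℝ, 0 < c ∧ ∃ᶠ x : ℕ in atTop,
        (c - 4 * twinPrimeConst) * (x : ℝ) ≤ twinBalancedFarSum x (rpowCut ε x) (z x) (Y x)) := by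
  rw [frequently_twinPrimeCount_ge_iff_twinTail_ge hε hε1]
  constructor
  · intro h
    refine frequently_mul_le_of_split (T := fun x => twinLocatedSum x (rpowCut ε x))
      (twinLocatedSum_rpowCut_split ε z Y) hU hW ?_
    simpa only [twinLocatedSum_rpowCut_eq_sum] using h
  · intro h
    have h' := frequently_mul_le_of_split (R := fun x => twinLocatedSum x (rpowCut ε x))
      (twinBalancedFarSum_rpowCut_split ε z Y) hU.neg_left hW.neg_left h
    simpa only [twinLocatedSum_rpowCut_eq_sum] using h'

/-! ### 5. Tier 2 ⟹ Tier 1 on the balanced far tail -/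

/-- The Hardy–Littlewood asymptotic gives a saving on `R` (under (F′), (F)). -/
theorem frequently_twinBalancedFarSum_ge_of_hardyLittlewood (hε : 0 < ε) (hε1 : ε < 1)
    (hU : (fun x => twinUnbalancedSum x (rpowCut ε x) (z x)) =o[atTop] fun x : ℕ => (x : ℝ))
    (hW : (fun x => twinBalancedWindowSum x (rpowCut ε x) (z x) (Y x)) =o[atTop] fun x : ℕ => (x : ℝ))
    (h : (fun x : ℕ => (twinPrimeCount x : ℝ)) ~[atTop]
      fun x : ℕ => 2 * twinPrimeConst * x / Real.log x ^ 2) :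
    ∃ c : ℝ, 0 < c ∧ ∃ᶠ x : ℕ in atTop,
      (c - 4 * twinPrimeConst) * (x : ℝ) ≤ twinBalancedFarSum x (rpowCut ε x) (z x) (Y x) := by
  refine frequently_mul_le_of_split (T := fun x => twinLocatedSum x (rpowCut ε x))
    (twinLocatedSum_rpowCut_split ε z Y) hU hW ?_
  simpa only [twinLocatedSum_rpowCut_eq_sum] using frequently_twinTail_ge_of_hardyLittlewood hε hε1 h

/-- Summary with the prose parameters `z = ⌊x^{1/2-ε₀}⌋`, `Y = ⌊x^{1+η}⌋` (paper.md §20): under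
(F′) and (F), ANY constant one-sided saving on the balanced far tail, infinitely often, gives the twin
prime conjecture. -/
theorem twinPrimeConjecture_of_frequently_balancedFarTail_rpow_ge (hε : 0 < ε) (hε1 : ε < 1)
    {ε₀ η : ℝ}
    (hU : (fun x => twinUnbalancedSum x (rpowCut ε x) (balanceCut ε₀ x))
      =o[atTop] fun x : ℕ => (x : ℝ))
    (hW : (fun x => twinBalancedWindowSum x (rpowCut ε x) (balanceCut ε₀ x) (productLevel η x))
      =o[atTop] fun x : ℕ => (x : ℝ))
    (h : ∃ c : ℝ, 0 < c ∧ ∃ᶠ x : ℕ in atTop,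
      (c - 4 * twinPrimeConst) * (x : ℝ)
        ≤ twinBalancedFarSum x (rpowCut ε x) (balanceCut ε₀ x) (productLevel η x)) :
    TwinPrimeConjecture :=
  twinPrimeConjecture_of_frequently_twinBalancedFarSum_ge (z := balanceCut ε₀) (Y := productLevel η)
    hε hε1 hU hW h

end Twin

end Summit.Parity.BatemanHorn.Theorems
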